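import Summits.ValiantsHypothesis.ValiantsHypothesis.Theorems.LacunarySymmetroidMatrixDescartesCensusSupportDescartes
import Summits.ValiantsHypothesis.ValiantsHypothesis.Theorems.LacunarySymmetroidMatrixDescartesCensusSupportNormalForm
import Summits.ValiantsHypothesis.ValiantsHypothesis.Theorems.LacunarySymmetroidMatrixDescartesCensusBox20Reduce
import Summits.ValiantsHypothesis.ValiantsHypothesis.Theorems.LacunarySymmetroidMatrixDescartesCensusMirror
import Summits.ValiantsHypothesis.ValiantsHypothesis.Theorems.LacunarySymmetroidMatrixDescartesCensusDefs

/-!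
# `MatrixDescartes` census — DOOR A at `(3,4)`: the BOX reduction, BOX10 in the kernel, and the 3-Sidon residue of `DoorA34`

HONEST FRAMING.  Object-search cell `pub-symmetroid`, route `LacunarySymmetroid`; this file sits beside ONE typed statement,
the route item `Theses.LacunarySymmetroid.DoorA34` (stmt-ValiantsHypothesis-19980) `= DoorA34 = PosRootLawAt 3 4 18`
(«every `4`-term real symmetric `3 × 3` lacunary pencil has at most `18 = D(3,4) − 1` distinct positive roots of its
determinant»), which is OPEN and asserted nowhere.  It is the `(3,4)` counterpart of the `(2,6)` BOX20 packaging
(`…CensusBox20.lean`, `Census.doorA26_box20`), and it is HONESTLY WEAKER, for a reason the file makes precise: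

* `doorA34_on_of_card_tripleSums_le` — the DESCARTES LAYER at `(3,4)`: a support `d : Fin 4 → ℕ` whose triple-sum table
  `{d i + d j + d k}` has at most `19` values carries the row `PosRootLawOn 3 4 18 d` for free
  (`Census.posRoots_three_le_of_card_tripleSums`); a REPEATED exponent leaves at most `10` values
  (`card_tripleSums_le_of_not_injective`, by collapsing the repeated letter).  So only 3-SIDON supports (all `20` triple
  sums distinct) can carry a Descartes-sharp `19`.
* `doorA34_box_of_sidonRows` — the BOX-`N` REDUCTION: the row holds on EVERY exponent vector whose entries lie in a window of
  width `N` as soon as it holds on the sorted 3-Sidon supports `0 = d₀ < d₁ < d₂ < d₃ ≤ N` (sorting `Tuple.sort` /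
  `Census.posRootLawOn_comp_equiv_iff`, translating `Census.posRootLawOn_add_const_iff`, and the Descartes layer).
* `doorA34_box10` — **BOX10 IN THE KERNEL, unconditionally**: every `d` with `d i ≤ d j + 10` satisfies `ζ(3,4; d) ≤ 18`,
  because NO support of width `≤ 10` is 3-Sidon (`sidon3_box10_enum`, `decide +kernel` over the `120` sorted supports).
  This is the whole V = 19 content of the box `d₃ − d₀ ≤ 10`: none.
* `sidon3_box13_enum`, `doorA34_box13_of_rows` — where the RESIDUE begins: the 3-Sidon supports with `d₃ ≤ 13` are exactly
  `28` (`14` mirror pairs, the first being `(0,1,7,11) / (0,4,10,11)` and `(0,1,8,11) / (0,3,10,11)`); BOX13 holds as soon as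
  the `14` representative rows do (mirrors by `Census.posRootLawOn_iff_mirror_rev`).  NONE of these `14` rows is proved
  here or anywhere in the tree: at `(3,4)` the cell's support-level certificates (engine-2 `LP34-CERT.md`: Newton cone C25 +
  Gårding rows) only exclude pencils with a DEFINITE letter, and no inequality row is known for the all-indefinite word
  (engine-2 `CUBIC-REREP.md` §13.2) — this is the located open core of `DoorA34`, stated here as an explicit finite list
  per box, not resolved.
* `doorA34_iff_sidon` — the all-supports form of the same bookkeeping: `DoorA34` holds iff the row holds on every
  PRIMITIVE sorted 3-Sidon support with `d₃ ≥ 11` (`Census.posRootLawAt_iff_primitive` + BOX10 + the Descartes layer).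

Nothing here bears on `DoorA34` beyond the box `d₃ − d₀ ≤ 10`, on `DoorA26`, on the crux `MatrixDescartes`
(stmt-ValiantsHypothesis-18050), or on `VP ≠ VNP`.

[folklore] Elementary bookkeeping + one finite enumeration; no citation exists or is needed.
-/

-- `Summit.ValiantsHypothesis.ValiantsHypothesis.…` repeats a component by the D-0017 layout
-- (single-conjunct summit), which the `dupNamespace` linter flags; the name is mandated.
set_option linter.dupNamespace false

namespace Summit.ValiantsHypothesis.ValiantsHypothesis.Theorems.LacunarySymmetroidMatrixDescartes.Census

open Polynomial Finset
open scoped BigOperators Polynomial Matrix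
open Summit.ValiantsHypothesis.ValiantsHypothesis.Theorems.MatrixDescartes.Negative (PosRootLawAt)

/-! ## The Descartes layer at `(3,4)` -/

/-- **Descartes layer at `(3,4)`**: if the triple-sum table of `d` has at most `19` values, then every `3 × 3` pencil on
`d` (symmetric or not) has at most `18` distinct positive roots of its determinant — the row `ζ(3,4; d) ≤ 18` for free. [folklore] -/
theorem doorA34_on_of_card_tripleSums_le (d : Fin 4 → ℕ)
    (hd : ((Finset.univ : Finset (Fin 4 × Fin 4 × Fin 4)).image (fun p => d p.1 + d p.2.1 + d p.2.2)).card ≤ 19) :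
    PosRootLawOn 3 4 18 d :=
  fun S _ => posRoots_three_le_of_card_tripleSums (B := 18) (by norm_num) d (by omega) S

/-- Collapsing a letter: if `d ∘ g = d` then the triple-sum table of `d` is indexed by the multisets `{g i, g j, g k}`,
so it has at most as many values as there are such multisets. [folklore] -/
theorem card_tripleSums_le_of_collapse (d : Fin 4 → ℕ) (g : Fin 4 → Fin 4) (hg : ∀ k, d (g k) = d k) {B : ℕ}
    (hM : ((Finset.univ : Finset (Fin 4 × Fin 4 × Fin 4)).image
      (fun p => ({g p.1, g p.2.1, g p.2.2} : Multiset (Fin 4)))).card ≤ B) :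
    ((Finset.univ : Finset (Fin 4 × Fin 4 × Fin 4)).image (fun p => d p.1 + d p.2.1 + d p.2.2)).card ≤ B := by
  classical
  have hsub : (Finset.univ : Finset (Fin 4 × Fin 4 × Fin 4)).image (fun p => d p.1 + d p.2.1 + d p.2.2)
      ⊆ ((Finset.univ : Finset (Fin 4 × Fin 4 × Fin 4)).image
          (fun p => ({g p.1, g p.2.1, g p.2.2} : Multiset (Fin 4)))).image (fun s => (s.map d).sum) := by
    intro x hx
    simp only [Finset.mem_image, Finset.mem_univ, true_and] at hx ⊢
    obtain ⟨p, rfl⟩ := hx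
    refine ⟨{g p.1, g p.2.1, g p.2.2}, ⟨p, rfl⟩, ?_⟩
    simp only [Multiset.insert_eq_cons, Multiset.map_cons, Multiset.map_singleton, Multiset.sum_cons,
      Multiset.sum_singleton, hg]
    ring
  exact (Finset.card_le_card hsub).trans (Finset.card_image_le.trans hM)

/-- **A repeated exponent leaves at most `10 ≤ 19` triple sums**: if `d : Fin 4 → ℕ` is not injective, its triple-sum
table has at most `19` values (indeed `10`: the size-`3` multisets of a `3`-set), so such supports lie in the Descartes layer. [folklore] -/
theorem card_tripleSums_le_of_not_injective (d : Fin 4 → ℕ) (hd : ¬ Function.Injective d) :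
    ((Finset.univ : Finset (Fin 4 × Fin 4 × Fin 4)).image (fun p => d p.1 + d p.2.1 + d p.2.2)).card ≤ 19 := by
  classical
  have hex : ∃ i j : Fin 4, i ≠ j ∧ d i = d j := by
    by_contra h
    push Not at h
    exact hd fun a b hab => by_contra fun hne => h a b hne hab
  obtain ⟨i, j, hij, hdij⟩ := hex
  refine card_tripleSums_le_of_collapse d (fun k => if k = j then i else k) (fun k => ?_) ?_
  · by_cases hk : k = j
    · simp [hk, hdij]
    · simp [hk]
  · fin_cases i <;> fin_cases j <;> first | exact absurd rfl hij | decide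

/-- The Descartes layer for non-injective exponent vectors. [folklore] -/
theorem doorA34_on_of_not_injective (d : Fin 4 → ℕ) (hd : ¬ Function.Injective d) : PosRootLawOn 3 4 18 d :=
  doorA34_on_of_card_tripleSums_le d (card_tripleSums_le_of_not_injective d hd)

/-! ## The BOX-`N` reduction: window vectors ⇐ sorted 3-Sidon supports of the box -/

/-- **BOX-`N` REDUCTION at `(3,4)`.**  Suppose the row `ζ(3,4; e) ≤ 18` holds for every SORTED 3-SIDON support of the box,
`0 = e₀ < e₁ < e₂ < e₃ ≤ N` with all `20` triple sums distinct.  Then it holds for EVERY exponent vector `d : Fin 4 → ℕ`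
whose entries lie in a window of width `N` (`d i ≤ d j + N`): repeated exponents by the Descartes layer, distinct ones by
sorting (`Census.posRootLawOn_comp_equiv_iff`), translating to `e₀ = 0` (`Census.posRootLawOn_add_const_iff`), and either
the Descartes layer again (`≤ 19` triple sums) or the hypothesis. [folklore] -/
theorem doorA34_box_of_sidonRows (N : ℕ)
    (hrows : ∀ e : Fin 4 → ℕ, StrictMono e → e 0 = 0 → e 3 ≤ N →
      20 ≤ ((Finset.univ : Finset (Fin 4 × Fin 4 × Fin 4)).image (fun p => e p.1 + e p.2.1 + e p.2.2)).card →
      PosRootLawOn 3 4 18 e)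
    (d : Fin 4 → ℕ) (hw : ∀ i j, d i ≤ d j + N) : PosRootLawOn 3 4 18 d := by
  classical
  by_cases hinj : Function.Injective d
  · -- sort
    set σ := Tuple.sort d with hσ
    have hmono : Monotone (d ∘ σ) := Tuple.monotone_sort d
    have hsm : StrictMono (d ∘ σ) := hmono.strictMono_of_injective (hinj.comp σ.injective)
    -- translate
    set m := (d ∘ σ) 0 with hm
    have hmle : ∀ l, m ≤ (d ∘ σ) l := fun l => hmono (Fin.zero_le l)
    set e : Fin 4 → ℕ := fun l => (d ∘ σ) l - m with he
    have hde : (d ∘ σ) = fun l => e l + m := by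
      funext l; simp only [he]; have := hmle l; omega
    have he_mono : StrictMono e := by
      intro a b hab; simp only [he]; have := hsm hab; have := hmle a; omega
    have he0 : e 0 = 0 := by simp [he, hm]
    have he3 : e 3 ≤ N := by
      simp only [he]
      have := hw (σ 3) (σ 0)
      simp only [hm, Function.comp] at this ⊢
      omega
    have hrow : PosRootLawOn 3 4 18 e := by
      by_cases hc : ((Finset.univ : Finset (Fin 4 × Fin 4 × Fin 4)).image (fun p => e p.1 + e p.2.1 + e p.2.2)).card ≤ 19
      · exact doorA34_on_of_card_tripleSums_le e hc
      · exact hrows e he_mono he0 he3 (by omega)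
    have hrow' : PosRootLawOn 3 4 18 (d ∘ σ) := by
      rw [hde]; exact (posRootLawOn_add_const_iff e m).mpr hrow
    exact (posRootLawOn_comp_equiv_iff σ d).mpr hrow'
  · exact doorA34_on_of_not_injective d hinj

/-! ## BOX10 in the kernel: no support of width `≤ 10` is 3-Sidon -/

set_option maxHeartbeats 4000000 in
/-- **No 3-Sidon support in the box `d₃ ≤ 10`** (`120` sorted supports `0 < a < b < c ≤ 10`, `decide +kernel`): the triple-sum
table of `(0,a,b,c)` always has at most `19` values.  (The first 3-Sidon supports are `(0,1,7,11)`, `(0,1,8,11)` and their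
mirrors, `sidon3_box13_enum`.) [folklore] -/
theorem sidon3_box10_enum : ∀ c ∈ List.range 11, ∀ b ∈ List.range c, ∀ a ∈ List.range b, 0 < a →
    ((Finset.univ : Finset (Fin 4 × Fin 4 × Fin 4)).image (fun p => (![0, a, b, c] : Fin 4 → ℕ) p.1 +
      (![0, a, b, c] : Fin 4 → ℕ) p.2.1 + (![0, a, b, c] : Fin 4 → ℕ) p.2.2)).card ≤ 19 := by
  intro c hc
  have hc' : c < 11 := List.mem_range.1 hc
  interval_cases c <;> decide +kernel

/-- **BOX10, sorted form**: every sorted support `0 = d₀ < d₁ < d₂ < d₃ ≤ 10` carries the row `ζ(3,4; d) ≤ 18` — by the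
Descartes layer alone, the box containing no 3-Sidon support. [folklore] -/
theorem doorA34_box10_sorted (d : Fin 4 → ℕ) (hd : StrictMono d) (h0 : d 0 = 0) (h3 : d 3 ≤ 10) :
    PosRootLawOn 3 4 18 d := by
  have hv : d = (![0, d 1, d 2, d 3] : Fin 4 → ℕ) := by
    funext l; fin_cases l <;> simp [h0]
  have h1 : 0 < d 1 := by have := hd (show (0 : Fin 4) < 1 by decide); omega
  have h19 := sidon3_box10_enum (d 3) (List.mem_range.2 (by omega)) (d 2) (List.mem_range.2 (hd (by decide)))
    (d 1) (List.mem_range.2 (hd (by decide))) h1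
  rw [hv]
  exact doorA34_on_of_card_tripleSums_le _ h19

/-- **BOX10 IN THE KERNEL (`(3,4)`)**: every exponent vector `d : Fin 4 → ℕ` whose entries lie in a window of width `10`
(`d i ≤ d j + 10` for all `i, j`) satisfies the door-A row `ζ(3,4; d) ≤ 18`: every real symmetric `3 × 3` four-term pencil
on such a support has at most `18` distinct positive roots of its determinant.  The `(3,4)` counterpart of
`Census.doorA26_box20` — but carried entirely by the Descartes layer: the V = 19 question of `DoorA34` starts at width `11`. [folklore] -/
theorem doorA34_box10 (d : Fin 4 → ℕ) (hw : ∀ i j, d i ≤ d j + 10) : PosRootLawOn 3 4 18 d :=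
  doorA34_box_of_sidonRows 10 (fun e he he0 he3 h20 => by
    have hv : e = (![0, e 1, e 2, e 3] : Fin 4 → ℕ) := by
      funext l; fin_cases l <;> simp [he0]
    have h1 : 0 < e 1 := by have := he (show (0 : Fin 4) < 1 by decide); omega
    have h19 := sidon3_box10_enum (e 3) (List.mem_range.2 (by omega)) (e 2) (List.mem_range.2 (he (by decide)))
      (e 1) (List.mem_range.2 (he (by decide))) h1
    rw [← hv] at h19
    omega) d hw

/-- BOX10 at the format level of the window: in particular every support with all exponents `≤ 10`. [folklore] -/
theorem doorA34_on_of_le_ten (d : Fin 4 → ℕ) (hd : ∀ l, d l ≤ 10) : PosRootLawOn 3 4 18 d :=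
  doorA34_box10 d fun i j => (hd i).trans (by omega)

/-! ## Where the residue begins: the 3-Sidon supports of the box `d₃ ≤ 13` -/

set_option maxHeartbeats 4000000 in
/-- **The 3-Sidon supports with `d₃ ≤ 13` are exactly `28`** (`14` mirror pairs; `decide +kernel` over the `286` sorted
supports): `(0,1,7,11)`, `(0,1,8,11)`, `(0,3,10,11)`, `(0,4,10,11)` at width `11`; eight at width `12`; sixteen at width `13`.
This is the index set of the first residue layer of `DoorA34` (engine-2's LP34 table starts here too). [folklore] -/
theorem sidon3_box13_enum : ∀ c ∈ List.range 14, ∀ b ∈ List.range c, ∀ a ∈ List.range b, 0 < a →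
    20 ≤ ((Finset.univ : Finset (Fin 4 × Fin 4 × Fin 4)).image (fun p => (![0, a, b, c] : Fin 4 → ℕ) p.1 +
      (![0, a, b, c] : Fin 4 → ℕ) p.2.1 + (![0, a, b, c] : Fin 4 → ℕ) p.2.2)).card →
    (![0, a, b, c] : Fin 4 → ℕ) ∈ ([![0, 1, 7, 11], ![0, 1, 8, 11], ![0, 3, 10, 11], ![0, 4, 10, 11], ![0, 1, 5, 12],
      ![0, 3, 7, 12], ![0, 1, 9, 12], ![0, 2, 9, 12], ![0, 5, 9, 12], ![0, 3, 10, 12], ![0, 3, 11, 12], ![0, 7, 11, 12],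
      ![0, 1, 4, 13], ![0, 3, 4, 13], ![0, 2, 7, 13], ![0, 5, 7, 13], ![0, 1, 8, 13], ![0, 2, 8, 13], ![0, 6, 8, 13],
      ![0, 1, 10, 13], ![0, 2, 10, 13], ![0, 9, 10, 13], ![0, 3, 11, 13], ![0, 5, 11, 13], ![0, 6, 11, 13], ![0, 3, 12, 13],
      ![0, 5, 12, 13], ![0, 9, 12, 13]] : List (Fin 4 → ℕ)) := by
  intro c hc
  have hc' : c < 14 := List.mem_range.1 hc
  interval_cases c <;> decide +kernel

/-- Mirror bookkeeping for the `(3,4)` table: a row on a support with `d l ≤ d 3` gives the row on the mirror support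
`l ↦ d 3 − d (3 − l)` (`Census.posRootLawOn_iff_mirror_rev`). [folklore] -/
theorem posRootLawOn_three_four_mirror {B : ℕ} (d : Fin 4 → ℕ) (hd : ∀ l, d l ≤ d 3)
    (h : PosRootLawOn 3 4 B d) : PosRootLawOn 3 4 B (fun l => d 3 - d (Fin.rev l)) :=
  (posRootLawOn_iff_mirror_rev d (d 3) hd).1 h

/-- **BOX13 modulo its residue**: IF the row `ζ(3,4; d) ≤ 18` holds on the `14` representative 3-Sidon supports of width
`11 ≤ d₃ ≤ 13` listed in the hypotheses (their `14` mirrors follow by `x ↦ x⁻¹`), THEN it holds on every exponent vector in a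
window of width `13`.  The `14` rows are OPEN (no certificate instrument of record reaches the all-indefinite word at
`(3,4)`); this theorem only records what BOX13 costs. [folklore] -/
theorem doorA34_box13_of_rows
    (r01 : PosRootLawOn 3 4 18 ![0, 1, 7, 11]) (r02 : PosRootLawOn 3 4 18 ![0, 1, 8, 11])
    (r03 : PosRootLawOn 3 4 18 ![0, 1, 5, 12]) (r04 : PosRootLawOn 3 4 18 ![0, 3, 7, 12])
    (r05 : PosRootLawOn 3 4 18 ![0, 1, 9, 12]) (r06 : PosRootLawOn 3 4 18 ![0, 2, 9, 12])
    (r07 : PosRootLawOn 3 4 18 ![0, 1, 4, 13]) (r08 : PosRootLawOn 3 4 18 ![0, 3, 4, 13])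
    (r09 : PosRootLawOn 3 4 18 ![0, 2, 7, 13]) (r10 : PosRootLawOn 3 4 18 ![0, 5, 7, 13])
    (r11 : PosRootLawOn 3 4 18 ![0, 1, 8, 13]) (r12 : PosRootLawOn 3 4 18 ![0, 2, 8, 13])
    (r13 : PosRootLawOn 3 4 18 ![0, 1, 10, 13]) (r14 : PosRootLawOn 3 4 18 ![0, 2, 10, 13]) :
    ∀ d : Fin 4 → ℕ, (∀ i j, d i ≤ d j + 13) → PosRootLawOn 3 4 18 d := by
  -- the fourteen mirror rows
  have m01 : PosRootLawOn 3 4 18 ![0, 4, 10, 11] := by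
    have h := posRootLawOn_three_four_mirror _ (by decide) r01
    have e : (fun l : Fin 4 => (![0, 1, 7, 11] : Fin 4 → ℕ) 3 - (![0, 1, 7, 11] : Fin 4 → ℕ) (Fin.rev l)) = ![0, 4, 10, 11] := by
      decide
    rwa [e] at h
  have m02 : PosRootLawOn 3 4 18 ![0, 3, 10, 11] := by
    have h := posRootLawOn_three_four_mirror _ (by decide) r02
    have e : (fun l : Fin 4 => (![0, 1, 8, 11] : Fin 4 → ℕ) 3 - (![0, 1, 8, 11] : Fin 4 → ℕ) (Fin.rev l)) = ![0, 3, 10, 11] := by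
      decide
    rwa [e] at h
  have m03 : PosRootLawOn 3 4 18 ![0, 7, 11, 12] := by
    have h := posRootLawOn_three_four_mirror _ (by decide) r03
    have e : (fun l : Fin 4 => (![0, 1, 5, 12] : Fin 4 → ℕ) 3 - (![0, 1, 5, 12] : Fin 4 → ℕ) (Fin.rev l)) = ![0, 7, 11, 12] := by
      decide
    rwa [e] at h
  have m04 : PosRootLawOn 3 4 18 ![0, 5, 9, 12] := by
    have h := posRootLawOn_three_four_mirror _ (by decide) r04
    have e : (fun l : Fin 4 => (![0, 3, 7, 12] : Fin 4 → ℕ) 3 - (![0, 3, 7, 12] : Fin 4 → ℕ) (Fin.rev l)) = ![0, 5, 9, 12] := by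
      decide
    rwa [e] at h
  have m05 : PosRootLawOn 3 4 18 ![0, 3, 11, 12] := by
    have h := posRootLawOn_three_four_mirror _ (by decide) r05
    have e : (fun l : Fin 4 => (![0, 1, 9, 12] : Fin 4 → ℕ) 3 - (![0, 1, 9, 12] : Fin 4 → ℕ) (Fin.rev l)) = ![0, 3, 11, 12] := by
      decide
    rwa [e] at h
  have m06 : PosRootLawOn 3 4 18 ![0, 3, 10, 12] := by
    have h := posRootLawOn_three_four_mirror _ (by decide) r06
    have e : (fun l : Fin 4 => (![0, 2, 9, 12] : Fin 4 → ℕ) 3 - (![0, 2, 9, 12] : Fin 4 → ℕ) (Fin.rev l)) = ![0, 3, 10, 12] := by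
      decide
    rwa [e] at h
  have m07 : PosRootLawOn 3 4 18 ![0, 9, 12, 13] := by
    have h := posRootLawOn_three_four_mirror _ (by decide) r07
    have e : (fun l : Fin 4 => (![0, 1, 4, 13] : Fin 4 → ℕ) 3 - (![0, 1, 4, 13] : Fin 4 → ℕ) (Fin.rev l)) = ![0, 9, 12, 13] := by
      decide
    rwa [e] at h
  have m08 : PosRootLawOn 3 4 18 ![0, 9, 10, 13] := by
    have h := posRootLawOn_three_four_mirror _ (by decide) r08
    have e : (fun l : Fin 4 => (![0, 3, 4, 13] : Fin 4 → ℕ) 3 - (![0, 3, 4, 13] : Fin 4 → ℕ) (Fin.rev l)) = ![0, 9, 10, 13] := by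
      decide
    rwa [e] at h
  have m09 : PosRootLawOn 3 4 18 ![0, 6, 11, 13] := by
    have h := posRootLawOn_three_four_mirror _ (by decide) r09
    have e : (fun l : Fin 4 => (![0, 2, 7, 13] : Fin 4 → ℕ) 3 - (![0, 2, 7, 13] : Fin 4 → ℕ) (Fin.rev l)) = ![0, 6, 11, 13] := by
      decide
    rwa [e] at h
  have m10 : PosRootLawOn 3 4 18 ![0, 6, 8, 13] := by
    have h := posRootLawOn_three_four_mirror _ (by decide) r10
    have e : (fun l : Fin 4 => (![0, 5, 7, 13] : Fin 4 → ℕ) 3 - (![0, 5, 7, 13] : Fin 4 → ℕ) (Fin.rev l)) = ![0, 6, 8, 13] := by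
      decide
    rwa [e] at h
  have m11 : PosRootLawOn 3 4 18 ![0, 5, 12, 13] := by
    have h := posRootLawOn_three_four_mirror _ (by decide) r11
    have e : (fun l : Fin 4 => (![0, 1, 8, 13] : Fin 4 → ℕ) 3 - (![0, 1, 8, 13] : Fin 4 → ℕ) (Fin.rev l)) = ![0, 5, 12, 13] := by
      decide
    rwa [e] at h
  have m12 : PosRootLawOn 3 4 18 ![0, 5, 11, 13] := by
    have h := posRootLawOn_three_four_mirror _ (by decide) r12
    have e : (fun l : Fin 4 => (![0, 2, 8, 13] : Fin 4 → ℕ) 3 - (![0, 2, 8, 13] : Fin 4 → ℕ) (Fin.rev l)) = ![0, 5, 11, 13] := by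
      decide
    rwa [e] at h
  have m13 : PosRootLawOn 3 4 18 ![0, 3, 12, 13] := by
    have h := posRootLawOn_three_four_mirror _ (by decide) r13
    have e : (fun l : Fin 4 => (![0, 1, 10, 13] : Fin 4 → ℕ) 3 - (![0, 1, 10, 13] : Fin 4 → ℕ) (Fin.rev l)) = ![0, 3, 12, 13] := by
      decide
    rwa [e] at h
  have m14 : PosRootLawOn 3 4 18 ![0, 3, 11, 13] := by
    have h := posRootLawOn_three_four_mirror _ (by decide) r14
    have e : (fun l : Fin 4 => (![0, 2, 10, 13] : Fin 4 → ℕ) 3 - (![0, 2, 10, 13] : Fin 4 → ℕ) (Fin.rev l)) = ![0, 3, 11, 13] := by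
      decide
    rwa [e] at h
  refine doorA34_box_of_sidonRows 13 (fun e he he0 he3 h20 => ?_)
  have hv : e = (![0, e 1, e 2, e 3] : Fin 4 → ℕ) := by
    funext l; fin_cases l <;> simp [he0]
  have h1 : 0 < e 1 := by have := he (show (0 : Fin 4) < 1 by decide); omega
  have h20' : 20 ≤ ((Finset.univ : Finset (Fin 4 × Fin 4 × Fin 4)).image (fun p => (![0, e 1, e 2, e 3] : Fin 4 → ℕ) p.1 +
      (![0, e 1, e 2, e 3] : Fin 4 → ℕ) p.2.1 + (![0, e 1, e 2, e 3] : Fin 4 → ℕ) p.2.2)).card := by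
    rw [← hv]; exact h20
  have hmem := sidon3_box13_enum (e 3) (List.mem_range.2 (by omega)) (e 2) (List.mem_range.2 (he (by decide)))
    (e 1) (List.mem_range.2 (he (by decide))) h1 h20'
  rw [hv]
  simp only [List.mem_cons, List.mem_nil_iff, or_false] at hmem
  rcases hmem with h | h | h | h | h | h | h | h | h | h | h | h | h | h | h | h | h | h | h | h | h | h | h | h | h | h | h | h
  · rw [h]; exact r01
  · rw [h]; exact r02
  · rw [h]; exact m02
  · rw [h]; exact m01
  · rw [h]; exact r03
  · rw [h]; exact r04
  · rw [h]; exact r05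
  · rw [h]; exact r06
  · rw [h]; exact m04
  · rw [h]; exact m06
  · rw [h]; exact m05
  · rw [h]; exact m03
  · rw [h]; exact r07
  · rw [h]; exact r08
  · rw [h]; exact r09
  · rw [h]; exact r10
  · rw [h]; exact r11
  · rw [h]; exact r12
  · rw [h]; exact m10
  · rw [h]; exact r13
  · rw [h]; exact r14
  · rw [h]; exact m08
  · rw [h]; exact m14
  · rw [h]; exact m12
  · rw [h]; exact m09
  · rw [h]; exact m13
  · rw [h]; exact m11
  · rw [h]; exact m07

/-! ## The all-supports form: `DoorA34` ⟺ the rows on primitive 3-Sidon supports of width `≥ 11` -/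

/-- **`DoorA34` reduces to its 3-Sidon residue.**  `DoorA34 = PosRootLawAt 3 4 18` holds iff the row `ζ(3,4; d) ≤ 18` holds
for every PRIMITIVE sorted support `0 = d₀ < d₁ < d₂ < d₃`, `gcd(d) = 1`, of width `d₃ ≥ 11` whose `20` triple sums are
pairwise distinct (3-Sidon).  Everything else — repeated or colliding exponents, the whole box `d₃ ≤ 10`, imprimitive
supports — is bookkeeping (`Census.posRootLawAt_iff_primitive`, the Descartes layer, `doorA34_box10_sorted`).  The right-hand
side is OPEN for every single such `d`. [folklore] -/
theorem doorA34_iff_sidon :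
    DoorA34 ↔ ∀ d : Fin 4 → ℕ, StrictMono d → d 0 = 0 → Finset.univ.gcd d = 1 → 11 ≤ d 3 →
      20 ≤ ((Finset.univ : Finset (Fin 4 × Fin 4 × Fin 4)).image (fun p => d p.1 + d p.2.1 + d p.2.2)).card →
      PosRootLawOn 3 4 18 d := by
  rw [show DoorA34 ↔ ∀ d : Fin 4 → ℕ, StrictMono d → d 0 = 0 → Finset.univ.gcd d = 1 → PosRootLawOn 3 4 18 d from
    posRootLawAt_iff_primitive 3 2 18]
  constructor
  · exact fun h d hd h0 hg _ _ => h d hd h0 hg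
  · intro h d hd h0 hg
    by_cases hc : ((Finset.univ : Finset (Fin 4 × Fin 4 × Fin 4)).image (fun p => d p.1 + d p.2.1 + d p.2.2)).card ≤ 19
    · exact doorA34_on_of_card_tripleSums_le d hc
    · by_cases h3 : d 3 ≤ 10
      · exact doorA34_box10_sorted d hd h0 h3
      · exact h d hd h0 hg (by omega) (by omega)

/-- `DoorA34` is equivalent to «BOX-`N` for every `N`» (the window form quantifies over the same exponent vectors). [folklore] -/
theorem doorA34_iff_forall_box :
    DoorA34 ↔ ∀ N : ℕ, ∀ d : Fin 4 → ℕ, (∀ i j, d i ≤ d j + N) → PosRootLawOn 3 4 18 d := by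
  constructor
  · exact fun h N d _ => h d
  · intro h d
    classical
    exact h (Finset.univ.sup d) d fun i j => (Finset.le_sup (Finset.mem_univ i)).trans (by omega)

end Summit.ValiantsHypothesis.ValiantsHypothesis.Theorems.LacunarySymmetroidMatrixDescartes.Census
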